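import Mathlib.Topology.MetricSpace.IsometricSMul
import Mathlib.Topology.MetricSpace.Isometry
import Mathlib.Topology.Algebra.ConstMulAction
import Mathlib.Topology.Connected.Clopen
import HarnessLib

/-!
# Submetries and the orbit pseudometric of an isometric group action

Two notions of metric geometry used throughout collapsing / equivariant Gromov–Hausdorff theory
(and, in `Literature/Geometry/Riemannian/AlmostNonnegRicciFibrationProofs.lean`, in the printed
proof of Huang–Huang–Wang–Zhu 2026, Main Theorem 1, §4 pp. 13–14: the orbit spaces
`Mᵢ = M̂ᵢ/Hᵢ`, `X̄ = (ℝˢ × Ŷ)/H₀`, `τᵢ⁻¹(Mᵢ)/Kᵢ`, and "`F : X̄ → Tˢ` is a submetry at scale `1/4`"),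
neither of which is in Mathlib (`rg -i submetry Mathlib` is empty; Mathlib topologizes the orbit
space `MulAction.orbitRel.Quotient G X` — `isOpenMap_quotient_mk'_mul` — but puts no distance on it):

§1. SUBMETRIES. `IsSubmetry f` (`f` maps every open ball ONTO the open ball of the same radius,
`f '' ball p r = ball (f p) r`; Berestovskii's notion, here with open balls as in the source) and its
scale-restricted form `IsSubmetryAtScale r₀ f` (only radii `r < r₀`; Huang–Huang–Wang–Zhu 2026,
p. 13). API: monotonicity in the scale, isometric equivalences and product projections are
submetries, composition,
the distance is non-increasing below the scale (`dist_le`), lifting of points (`exists_eq_of_dist_lt`),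
and surjectivity onto a preconnected space (`surjective`).

§2. THE ORBIT PSEUDOMETRIC. For a group `G` acting by isometries on a pseudometric space `X`,
`orbitDist G x y = ⨅ g, dist x (g • y)`; it is symmetric, `G`-invariant in both variables and
satisfies the triangle inequality, so it descends to a `PseudoMetricSpace` structure on the orbit
space `MulAction.orbitRel.Quotient G X` (a new instance; Mathlib has none on this type) whose
topology is (definitionally) Mathlib's quotient
topology (`PseudoMetricSpace.ofDistTopology`; the compatibility holds for every isometric action,
with no properness or closed-orbit hypothesis, because the quotient map is open). API:
`dist_mk_mk`, `dist_mk_mk_le`, `exists_dist_smul_lt`, and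

§3. QUOTIENT MAPS ARE SUBMETRIES: the orbit map `X → X/G` is a submetry (`isSubmetry_mk`), and an
equivariant submetry (at scale `r₀`) `π : X → B` between isometric `G`-spaces descends to a submetry
(at scale `r₀`) `X/G → B/G` (`IsSubmetryAtScale.descend`) — the mechanism behind "`F : X̄ → Tˢ` is a
submetry" (projection `ℝˢ × Ŷ → ℝˢ` modulo `H₀`) and behind the quotient fibrations `F̂ᵢ` of p. 14.

§4. THE ISOMETRY GROUP ACTS: the tautological `MulAction (X ≃ᵢ X) X` (absent from Mathlib) and
the `IsIsometricSMul` instances for it and for subgroups `S ≤ X ≃ᵢ X`, so that limit groups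
`G ≤ Isom(X)` of equivariant Gromov–Hausdorff theory act on `X` and have orbit spaces `X/G` (§2).

Everything is a definition with body or a proved theorem; no named facts.

## References

* V. N. Berestovskii, L. Guijarro, *A metric characterization of Riemannian submersions*,
  Ann. Global Anal. Geom. 18 (2000) 577–588 (submetries). Cited textually; the notion is folklore.
* H. Huang, X.-T. Huang, J. Wang, X. Zhu, arXiv:2605.24380 (2026), §1 p. 5, §4 pp. 13–14.
  [HuangHuangWangZhu2026]
-/

noncomputable section

open Metric Set Filter
open scoped Topology Pointwise

namespace Literature.Geometry.MetricGeometry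

/-! ### §1. Submetries -/

section Submetry

variable {X Y Z : Type*} [PseudoMetricSpace X] [PseudoMetricSpace Y] [PseudoMetricSpace Z]

/-- A map `f : X → Y` of pseudometric spaces is a **submetry** if it maps every open ball onto the
open ball of the same radius: `f(B_r(p)) = B_r(f p)` for all `p` and `r > 0` (Berestovskii; open-ball
form). Equivalently: `f` does not increase distances and every point at distance `< r` from `f p`
lifts to a point at distance `< r` from `p`. [folklore] -/
def IsSubmetry (f : X → Y) : Prop :=
  ∀ (p : X) (r : ℝ), 0 < r → f '' ball p r = ball (f p) r

/-- A map `f : X → Y` is a **submetry at scale `r₀`** if `f(B_r(p)) = B_r(f p)` for all `p` and all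
radii `0 < r < r₀` (Huang–Huang–Wang–Zhu 2026, §4, p. 13: "`F` is a submetry at scale `1/4`"; the
`δ = 0` companion of their `δ`-almost submetries at scale `r₀`, §1 p. 5).
[cite: HuangHuangWangZhu2026, §4 p. 13] -/
def IsSubmetryAtScale (r₀ : ℝ) (f : X → Y) : Prop :=
  ∀ (p : X) (r : ℝ), 0 < r → r < r₀ → f '' ball p r = ball (f p) r

variable {f : X → Y} {g : Y → Z} {r₀ r₀' : ℝ}

/-- Unfolding lemma for `IsSubmetry`. [folklore] -/
theorem isSubmetry_iff : IsSubmetry f ↔ ∀ (p : X) (r : ℝ), 0 < r → f '' ball p r = ball (f p) r :=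
  Iff.rfl

/-- Unfolding lemma for `IsSubmetryAtScale`. [folklore] -/
theorem isSubmetryAtScale_iff : IsSubmetryAtScale r₀ f ↔
    ∀ (p : X) (r : ℝ), 0 < r → r < r₀ → f '' ball p r = ball (f p) r :=
  Iff.rfl

/-- A submetry is a submetry at every scale. [folklore] -/
theorem IsSubmetry.atScale (hf : IsSubmetry f) (r₀ : ℝ) : IsSubmetryAtScale r₀ f :=
  fun p r hr _ ↦ hf p r hr

/-- A map is a submetry iff it is a submetry at every scale. [folklore] -/
theorem isSubmetry_iff_forall_atScale : IsSubmetry f ↔ ∀ r₀ : ℝ, IsSubmetryAtScale r₀ f :=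
  ⟨fun h r₀ ↦ h.atScale r₀, fun h p r hr ↦ h (r + 1) p r hr (by linarith)⟩

/-- Monotonicity in the scale. [folklore] -/
theorem IsSubmetryAtScale.mono (hf : IsSubmetryAtScale r₀ f) (h : r₀' ≤ r₀) :
    IsSubmetryAtScale r₀' f :=
  fun p r hr hr' ↦ hf p r hr (lt_of_lt_of_le hr' h)

/-- An isometric equivalence is a submetry. [folklore] -/
theorem _root_.IsometryEquiv.isSubmetry (e : X ≃ᵢ Y) : IsSubmetry (e : X → Y) :=
  fun p r _ ↦ e.image_ball p r

/-- The identity is a submetry. [folklore] -/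
theorem isSubmetry_id : IsSubmetry (id : X → X) :=
  fun p r _ ↦ by simp

/-- The first projection of a product (Mathlib's sup metric) is a submetry: lift `b` near `p.1`
to `(b, p.2)`. (For the `ℓ²` product metric `WithLp 2 (X × Y)` the same lift works; not needed
here.) [folklore] -/
theorem isSubmetry_fst : IsSubmetry (Prod.fst : X × Y → X) := by
  intro p r _
  apply Subset.antisymm
  · rintro _ ⟨x, hx, rfl⟩
    rw [mem_ball] at hx ⊢
    exact lt_of_le_of_lt (by rw [Prod.dist_eq]; exact le_max_left _ _) hx
  · intro b hb
    refine ⟨(b, p.2), ?_, rfl⟩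
    rw [mem_ball] at hb ⊢
    rw [Prod.dist_eq]
    simp [hb]

/-- The second projection of a product (sup metric) is a submetry. [folklore] -/
theorem isSubmetry_snd : IsSubmetry (Prod.snd : X × Y → Y) := by
  intro p r _
  apply Subset.antisymm
  · rintro _ ⟨x, hx, rfl⟩
    rw [mem_ball] at hx ⊢
    exact lt_of_le_of_lt (by rw [Prod.dist_eq]; exact le_max_right _ _) hx
  · intro b hb
    refine ⟨(p.1, b), ?_, rfl⟩
    rw [mem_ball] at hb ⊢
    rw [Prod.dist_eq]
    simp [hb]

/-- Composition of submetries at scale `r₀`. [folklore] -/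
theorem IsSubmetryAtScale.comp (hg : IsSubmetryAtScale r₀ g) (hf : IsSubmetryAtScale r₀ f) :
    IsSubmetryAtScale r₀ (g ∘ f) := fun p r hr hr' ↦ by
  rw [image_comp, hf p r hr hr', hg (f p) r hr hr']
  rfl

/-- Composition of submetries. [folklore] -/
theorem IsSubmetry.comp (hg : IsSubmetry g) (hf : IsSubmetry f) : IsSubmetry (g ∘ f) :=
  isSubmetry_iff_forall_atScale.2 fun r₀ ↦ (hg.atScale r₀).comp (hf.atScale r₀)

/-- A submetry at scale `r₀` does not increase distances below the scale:
`dist x p < r₀ ⇒ dist (f x) (f p) ≤ dist x p` (from `f(B_r(p)) ⊆ B_r(f p)` for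
`dist x p < r < r₀`). [folklore] -/
theorem IsSubmetryAtScale.dist_le (hf : IsSubmetryAtScale r₀ f) {x p : X} (h : dist x p < r₀) :
    dist (f x) (f p) ≤ dist x p := by
  by_contra hlt
  rw [not_le] at hlt
  set r := min ((dist x p + dist (f x) (f p)) / 2) ((dist x p + r₀) / 2) with hr
  have h0 : 0 ≤ dist x p := dist_nonneg
  have hxr : dist x p < r := lt_min (by linarith) (by linarith)
  have hr0 : 0 < r := h0.trans_lt hxr
  have hrr₀ : r < r₀ := (min_le_right _ _).trans_lt (by linarith)
  have hmem : f x ∈ ball (f p) r := by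
    rw [← hf p r hr0 hrr₀]
    exact mem_image_of_mem f (mem_ball.mpr hxr)
  rw [mem_ball] at hmem
  have : r ≤ (dist x p + dist (f x) (f p)) / 2 := min_le_left _ _
  linarith

/-- A submetry does not increase distances (is `1`-Lipschitz). [folklore] -/
theorem IsSubmetry.dist_le (hf : IsSubmetry f) (x p : X) : dist (f x) (f p) ≤ dist x p :=
  (hf.atScale (dist x p + 1)).dist_le (by linarith)

/-- A submetry is `1`-Lipschitz. [folklore] -/
theorem IsSubmetry.lipschitzWith (hf : IsSubmetry f) : LipschitzWith 1 f :=
  LipschitzWith.of_dist_le_mul fun x y ↦ by simpa using hf.dist_le x y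

/-- LIFTING: under a submetry at scale `r₀`, a point `y` with `dist y (f p) < r < r₀` is the image of
a point `x` with `dist x p < r`. [folklore] -/
theorem IsSubmetryAtScale.exists_eq_of_dist_lt (hf : IsSubmetryAtScale r₀ f) {p : X} {y : Y}
    {r : ℝ} (hy : dist y (f p) < r) (hr : r < r₀) : ∃ x : X, f x = y ∧ dist x p < r := by
  have hr0 : 0 < r := dist_nonneg.trans_lt hy
  have hmem : y ∈ f '' ball p r := by
    rw [hf p r hr0 hr]
    exact mem_ball.mpr hy
  obtain ⟨x, hx, rfl⟩ := hmem
  exact ⟨x, rfl, mem_ball.mp hx⟩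

/-- LIFTING for submetries: every `y` is the image of a point `x` with `dist x p < r` as soon as
`dist y (f p) < r`. [folklore] -/
theorem IsSubmetry.exists_eq_of_dist_lt (hf : IsSubmetry f) {p : X} {y : Y} {r : ℝ}
    (hy : dist y (f p) < r) : ∃ x : X, f x = y ∧ dist x p < r :=
  (hf.atScale (r + 1)).exists_eq_of_dist_lt hy (by linarith)

/-- A submetry at a positive scale from a nonempty space to a PRECONNECTED space is onto: its range
is open (it contains `B_{r₀/2}(f x) = f(B_{r₀/2}(x))`) and closed (a point in the closure of the
range lies in such a ball). [folklore] -/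
theorem IsSubmetryAtScale.surjective [PreconnectedSpace Y] [Nonempty X]
    (hf : IsSubmetryAtScale r₀ f) (h0 : 0 < r₀) : Function.Surjective f := by
  suffices hU : range f = univ from fun y ↦ (hU ▸ mem_univ y : y ∈ range f)
  have hball : ∀ x : X, ball (f x) (r₀ / 2) ⊆ range f := fun x ↦ by
    rw [← hf x (r₀ / 2) (by linarith) (by linarith)]
    exact image_subset_range _ _
  refine IsClopen.eq_univ ⟨?_, ?_⟩ (range_nonempty f)
  · apply isClosed_of_closure_subset
    intro y hy
    rw [Metric.mem_closure_iff] at hy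
    obtain ⟨_, ⟨x, rfl⟩, hxy⟩ := hy (r₀ / 2) (by linarith)
    exact hball x (mem_ball.mpr hxy)
  · rw [isOpen_iff_forall_mem_open]
    rintro _ ⟨x, rfl⟩
    exact ⟨ball (f x) (r₀ / 2), hball x, isOpen_ball, mem_ball_self (by linarith)⟩

/-- A submetry from a nonempty space onto a preconnected space is surjective. [folklore] -/
theorem IsSubmetry.surjective [PreconnectedSpace Y] [Nonempty X] (hf : IsSubmetry f) :
    Function.Surjective f :=
  (hf.atScale 1).surjective one_pos

end Submetry

/-! ### §2. The orbit pseudometric -/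

section EquivariantMap

variable {G X B : Type*} [Group G] [MulAction G X] [MulAction G B]

/-- The map of orbit spaces `X/G → B/G` induced by a `G`-equivariant map `π : X → B`. [folklore] -/
def orbitQuotientMap (π : X → B) (hπ : ∀ (g : G) (x : X), π (g • x) = g • π x) :
    MulAction.orbitRel.Quotient G X → MulAction.orbitRel.Quotient G B :=
  Quotient.map' π fun x y hxy ↦ by
    obtain ⟨g, rfl⟩ := MulAction.orbitRel_apply.mp hxy
    exact MulAction.orbitRel_apply.mpr ⟨g, (hπ g y).symm⟩

/-- `orbitQuotientMap π ⟦x⟧ = ⟦π x⟧`. [folklore] -/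
@[simp]
theorem orbitQuotientMap_mk (π : X → B) (hπ : ∀ (g : G) (x : X), π (g • x) = g • π x) (x : X) :
    orbitQuotientMap π hπ ⟦x⟧ = ⟦π x⟧ :=
  rfl

end EquivariantMap

section OrbitSpace

variable (G : Type*) {X : Type*} [Group G] [PseudoMetricSpace X] [MulAction G X]

/-- The **orbit (pseudo)distance** of an isometric action: `orbitDist G x y = ⨅ g, dist x (g • y)`,
the distance from `x` to the orbit of `y` (equivalently, by isometry invariance, the distance between
the two orbits). [folklore] -/
def orbitDist (x y : X) : ℝ :=
  ⨅ g : G, dist x (g • y)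

variable {G}

/-- The defining infimum is bounded below (by `0`). [folklore] -/
theorem bddBelow_range_dist_smul (x y : X) : BddBelow (range fun g : G ↦ dist x (g • y)) :=
  ⟨0, by rintro _ ⟨g, rfl⟩; exact dist_nonneg⟩

/-- `orbitDist G x y ≤ dist x (g • y)` for every `g`. [folklore] -/
theorem orbitDist_le (x y : X) (g : G) : orbitDist G x y ≤ dist x (g • y) :=
  ciInf_le (bddBelow_range_dist_smul x y) g

/-- `orbitDist G x y ≤ dist x y` (take `g = 1`). [folklore] -/
theorem orbitDist_le_dist (x y : X) : orbitDist G x y ≤ dist x y := by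
  simpa using orbitDist_le x y (1 : G)

/-- The orbit distance is nonnegative. [folklore] -/
theorem orbitDist_nonneg (x y : X) : 0 ≤ orbitDist G x y :=
  le_ciInf fun _ ↦ dist_nonneg

/-- `orbitDist G x x = 0`. [folklore] -/
theorem orbitDist_self (x : X) : orbitDist G x x = 0 :=
  le_antisymm (by simpa using orbitDist_le x x (1 : G)) (orbitDist_nonneg x x)

/-- If `orbitDist G x y < r` then some translate `g • y` is at distance `< r` from `x`. [folklore] -/
theorem exists_dist_smul_lt {x y : X} {r : ℝ} (h : orbitDist G x y < r) :
    ∃ g : G, dist x (g • y) < r :=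
  exists_lt_of_ciInf_lt h

/-- Invariance in the second variable: `orbitDist G x (h • y) = orbitDist G x y`. [folklore] -/
theorem orbitDist_smul_right (x y : X) (h : G) : orbitDist G x (h • y) = orbitDist G x y := by
  unfold orbitDist
  simp_rw [smul_smul]
  exact (Equiv.mulRight h).iInf_comp (g := fun g : G ↦ dist x (g • y))

variable [IsIsometricSMul G X]

/-- Invariance in the first variable: `orbitDist G (h • x) y = orbitDist G x y`. [folklore] -/
theorem orbitDist_smul_left (x y : X) (h : G) : orbitDist G (h • x) y = orbitDist G x y := by
  unfold orbitDist
  have : ∀ g : G, dist (h • x) (g • y) = dist x ((h⁻¹ * g) • y) := fun g ↦ by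
    rw [← dist_smul h⁻¹ (h • x) (g • y), smul_smul, smul_smul, inv_mul_cancel, one_smul]
  simp_rw [this]
  exact (Equiv.mulLeft h⁻¹).iInf_comp (g := fun g : G ↦ dist x (g • y))

/-- Symmetry: `orbitDist G x y = orbitDist G y x` (reindex `g ↦ g⁻¹`). [folklore] -/
theorem orbitDist_comm (x y : X) : orbitDist G x y = orbitDist G y x := by
  unfold orbitDist
  have : ∀ g : G, dist x (g • y) = dist y (g⁻¹ • x) := fun g ↦ by
    rw [← dist_smul g⁻¹ x (g • y), smul_smul, inv_mul_cancel, one_smul, dist_comm]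
  simp_rw [this]
  exact (Equiv.inv G).iInf_comp (g := fun g : G ↦ dist y (g • x))

/-- Triangle inequality for the orbit distance. [folklore] -/
theorem orbitDist_triangle (x y z : X) : orbitDist G x z ≤ orbitDist G x y + orbitDist G y z := by
  refine le_of_forall_pos_lt_add fun ε hε ↦ ?_
  obtain ⟨g₁, h₁⟩ := exists_dist_smul_lt (lt_add_of_pos_right (orbitDist G x y) (half_pos hε))
  obtain ⟨g₂, h₂⟩ := exists_dist_smul_lt (lt_add_of_pos_right (orbitDist G y z) (half_pos hε))
  calc orbitDist G x z ≤ dist x ((g₁ * g₂) • z) := orbitDist_le x z (g₁ * g₂)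
    _ ≤ dist x (g₁ • y) + dist (g₁ • y) ((g₁ * g₂) • z) := dist_triangle _ _ _
    _ = dist x (g₁ • y) + dist y (g₂ • z) := by rw [← smul_smul, dist_smul]
    _ < orbitDist G x y + orbitDist G y z + ε := by linarith

/-- The orbit distance only depends on the orbits. [folklore] -/
theorem orbitDist_congr {x x' y y' : X} (hx : MulAction.orbitRel G X x x')
    (hy : MulAction.orbitRel G X y y') : orbitDist G x y = orbitDist G x' y' := by
  obtain ⟨g, rfl⟩ := MulAction.orbitRel_apply.mp hx
  obtain ⟨h, rfl⟩ := MulAction.orbitRel_apply.mp hy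
  rw [orbitDist_smul_left, orbitDist_smul_right]

variable (G X) in
/-- The **orbit pseudometric** on the orbit space `X/G = MulAction.orbitRel.Quotient G X` of an
isometric group action: `dist ⟦x⟧ ⟦y⟧ = ⨅ g, dist x (g • y)`. Its topology is, definitionally,
Mathlib's quotient topology (`PseudoMetricSpace.ofDistTopology`): a set of orbits is open for the
quotient topology iff it contains an `orbitDist`-ball around each of its points, because the orbit
map is open (`isOpenMap_quotient_mk'_mul`) and `orbitDist G x y < ε` iff some `g • y ∈ B_ε(x)`.
Orbits need not be closed, so this is only a pseudometric. This instance is NEW (Mathlib puts no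
distance on orbit spaces of isometric actions, so nothing is overridden); Mathlib's quotient seminorm
on `M ⧸ S` for a seminormed commutative group (`QuotientGroup.instSeminormedCommGroup`, a structure
on `Quotient (QuotientGroup.leftRel S)`) is the special case of the translation action of `S.op`,
has the same distance function, and is not matched by this instance (different head constant), so no
instance diamond arises on `M ⧸ S`. [folklore] -/
instance instPseudoMetricSpaceOrbitRelQuotient :
    PseudoMetricSpace (MulAction.orbitRel.Quotient G X) :=
  PseudoMetricSpace.ofDistTopology
    (Quotient.lift₂ (s₁ := MulAction.orbitRel G X) (s₂ := MulAction.orbitRel G X) (orbitDist G)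
      fun _ _ _ _ hx hy ↦ orbitDist_congr hx hy)
    (fun q ↦ Quotient.inductionOn q fun x ↦ orbitDist_self x)
    (fun q q' ↦ Quotient.inductionOn₂ q q' fun x y ↦ orbitDist_comm x y)
    (fun q q' q'' ↦ Quotient.inductionOn₃ q q' q'' fun x y z ↦ orbitDist_triangle x y z)
    (by
      intro s
      have hcont : Continuous (fun x : X ↦ (⟦x⟧ : MulAction.orbitRel.Quotient G X)) :=
        continuous_quotient_mk'
      constructor
      · intro hs q hq
        induction q using Quotient.inductionOn with
        | h x =>
          have hpre : IsOpen ((fun x : X ↦ (⟦x⟧ : MulAction.orbitRel.Quotient G X)) ⁻¹' s) :=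
            hs.preimage hcont
          obtain ⟨ε, hε, hball⟩ := Metric.isOpen_iff.mp hpre x hq
          refine ⟨ε, hε, fun q' hq' ↦ ?_⟩
          induction q' using Quotient.inductionOn with
          | h y =>
            obtain ⟨g, hg⟩ := exists_dist_smul_lt (G := G) (x := x) (y := y) (r := ε) hq'
            have hmem : g • y ∈ (fun x : X ↦ (⟦x⟧ : MulAction.orbitRel.Quotient G X)) ⁻¹' s :=
              hball (mem_ball.mpr (by rwa [dist_comm]))
            have heq : (⟦g • y⟧ : MulAction.orbitRel.Quotient G X) = ⟦y⟧ :=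
              Quotient.sound (MulAction.orbitRel_apply.mpr (MulAction.mem_orbit y g))
            rw [mem_preimage, heq] at hmem
            exact hmem
      · intro hs
        rw [isOpen_coinduced, Metric.isOpen_iff]
        intro x hx
        obtain ⟨ε, hε, hball⟩ := hs _ hx
        refine ⟨ε, hε, fun y hy ↦ hball _ ?_⟩
        have hy' : dist x y < ε := by rw [dist_comm]; exact mem_ball.mp hy
        exact lt_of_le_of_lt (orbitDist_le_dist x y) hy')

/-- The distance on the orbit space: `dist ⟦x⟧ ⟦y⟧ = ⨅ g, dist x (g • y)`. [folklore] -/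
theorem dist_mk_mk (x y : X) :
    dist (⟦x⟧ : MulAction.orbitRel.Quotient G X) ⟦y⟧ = ⨅ g : G, dist x (g • y) :=
  rfl

/-- The orbit map does not increase distances: `dist ⟦x⟧ ⟦y⟧ ≤ dist x y`. [folklore] -/
theorem dist_mk_mk_le (x y : X) : dist (⟦x⟧ : MulAction.orbitRel.Quotient G X) ⟦y⟧ ≤ dist x y :=
  orbitDist_le_dist x y

/-- `dist ⟦x⟧ ⟦y⟧ ≤ dist x (g • y)` for every `g`. [folklore] -/
theorem dist_mk_mk_le_dist_smul (x y : X) (g : G) :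
    dist (⟦x⟧ : MulAction.orbitRel.Quotient G X) ⟦y⟧ ≤ dist x (g • y) :=
  orbitDist_le x y g

/-- If `dist ⟦x⟧ ⟦y⟧ < r` then `dist x (g • y) < r` for some `g`. [folklore] -/
theorem exists_dist_smul_lt_of_dist_mk_mk_lt {x y : X} {r : ℝ}
    (h : dist (⟦x⟧ : MulAction.orbitRel.Quotient G X) ⟦y⟧ < r) : ∃ g : G, dist x (g • y) < r :=
  exists_dist_smul_lt h

/-! ### §3. Orbit maps are submetries; equivariant submetries descend -/

variable (G X) in
/-- The orbit map `X → X/G` of an isometric action is a submetry: `⟦B_r(x)⟧ = B_r(⟦x⟧)`.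
(Huang–Huang–Wang–Zhu 2026 use this for `ℝˢ × Ŷ → X̄ = (ℝˢ × Ŷ)/H₀` and `M̂ᵢ → Mᵢ`, §4 p. 13.)
[folklore] -/
theorem isSubmetry_mk : IsSubmetry (fun x : X ↦ (⟦x⟧ : MulAction.orbitRel.Quotient G X)) := by
  intro p r _
  apply Subset.antisymm
  · rintro _ ⟨x, hx, rfl⟩
    exact mem_ball.mpr (lt_of_le_of_lt (dist_mk_mk_le x p) (mem_ball.mp hx))
  · intro q hq
    induction q using Quotient.inductionOn with
    | h y =>
      rw [mem_ball, dist_comm] at hq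
      obtain ⟨g, hg⟩ := exists_dist_smul_lt_of_dist_mk_mk_lt hq
      refine ⟨g • y, mem_ball.mpr (by rwa [dist_comm]), ?_⟩
      exact Quotient.sound (MulAction.orbitRel_apply.mpr (MulAction.mem_orbit y g))

variable {B : Type*} [PseudoMetricSpace B] [MulAction G B] [IsIsometricSMul G B]

/-- DESCENT OF EQUIVARIANT SUBMETRIES: if `G` acts isometrically on `X` and `B` and `π : X → B` is a
`G`-equivariant submetry at scale `r₀`, the induced map `X/G → B/G` is a submetry at scale `r₀`.
(For `π` the projection `ℝˢ × Ŷ → ℝˢ` and `G = H₀` this is "`F : X̄ → Tˢ` is a submetry at scale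
`1/4`", Huang–Huang–Wang–Zhu 2026, §4 p. 13; for `π = Fᵢ` and `G = Kᵢ` it is the quotient
fibration `F̂ᵢ : Mᵢ → Tˢ/Kᵢ'` of p. 14, at the metric level.) Proof: if `dist ⟦x⟧ ⟦x'⟧ < r` pick `g`
with `dist x (g • x') < r`, so `dist (π x) (g • π x') < r`; conversely if `dist ⟦π x⟧ ⟦b⟧ < r` pick
`g` with `dist (π x) (g • b) < r` and lift `g • b = π x'` with `dist x' x < r`.
[cite: HuangHuangWangZhu2026, §4 pp. 13–14] -/
theorem IsSubmetryAtScale.descend {π : X → B} {r₀ : ℝ} (hπ : ∀ (g : G) (x : X), π (g • x) = g • π x)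
    (hsub : IsSubmetryAtScale r₀ π) : IsSubmetryAtScale r₀ (orbitQuotientMap π hπ) := by
  intro q r hr hrr₀
  induction q using Quotient.inductionOn with
  | h x =>
    apply Subset.antisymm
    · rintro _ ⟨q', hq', rfl⟩
      induction q' using Quotient.inductionOn with
      | h x' =>
        rw [mem_ball] at hq' ⊢
        obtain ⟨g, hg⟩ := exists_dist_smul_lt_of_dist_mk_mk_lt (by rwa [dist_comm] at hq')
        -- `hg : dist x (g • x') < r`
        have h1 : dist (π (g • x')) (π x) ≤ dist (g • x') x :=
          hsub.dist_le (lt_trans (by rwa [dist_comm] at hg) hrr₀)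
        change dist (⟦π x'⟧ : MulAction.orbitRel.Quotient G B) ⟦π x⟧ < r
        calc dist (⟦π x'⟧ : MulAction.orbitRel.Quotient G B) ⟦π x⟧
            = dist (⟦π x⟧ : MulAction.orbitRel.Quotient G B) ⟦π x'⟧ := dist_comm _ _
          _ ≤ dist (π x) (g • π x') := dist_mk_mk_le_dist_smul _ _ g
          _ = dist (π (g • x')) (π x) := by rw [hπ, dist_comm]
          _ ≤ dist (g • x') x := h1
          _ < r := by rwa [dist_comm] at hg
    · intro q' hq'
      induction q' using Quotient.inductionOn with
      | h b =>
        rw [mem_ball] at hq'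
        change dist (⟦b⟧ : MulAction.orbitRel.Quotient G B) ⟦π x⟧ < r at hq'
        obtain ⟨g, hg⟩ := exists_dist_smul_lt_of_dist_mk_mk_lt (by rwa [dist_comm] at hq')
        -- `hg : dist (π x) (g • b) < r`; lift `g • b`
        obtain ⟨x', hx', hdist⟩ := hsub.exists_eq_of_dist_lt (by rwa [dist_comm] at hg) hrr₀
        refine ⟨⟦x'⟧, mem_ball.mpr (lt_of_le_of_lt (dist_mk_mk_le x' x) hdist), ?_⟩
        rw [orbitQuotientMap_mk, hx']
        exact Quotient.sound (MulAction.orbitRel_apply.mpr (MulAction.mem_orbit b g))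

/-- Descent of equivariant submetries (global scale). [folklore] -/
theorem IsSubmetry.descend {π : X → B} (hπ : ∀ (g : G) (x : X), π (g • x) = g • π x)
    (hsub : IsSubmetry π) : IsSubmetry (orbitQuotientMap π hπ) :=
  isSubmetry_iff_forall_atScale.2 fun r₀ ↦ (hsub.atScale r₀).descend hπ

end OrbitSpace


/-! ### §4. The isometry group `Isom(X) = X ≃ᵢ X` and its subgroups act isometrically on `X` -/

section IsometryGroupAction

variable {X : Type*} [PseudoEMetricSpace X]

/-- The tautological action of the isometry group `X ≃ᵢ X` on `X`, `g • x = g x`. Mathlib has the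
group structure (`IsometryEquiv.instGroup`, `mul_apply : (e₁ * e₂) x = e₁ (e₂ x)`) but registers no
action; this is the action by which "closed subgroups `G ≤ Isom(X)`" act in equivariant
Gromov–Hausdorff theory (Huang–Huang–Wang–Zhu 2026, §2.1). [folklore] -/
instance IsometryEquiv.applyMulAction : MulAction (X ≃ᵢ X) X where
  smul g x := g x
  one_smul _ := rfl
  mul_smul _ _ _ := rfl

/-- `g • x = g x`. [folklore] -/
@[simp]
theorem IsometryEquiv.smul_def (g : X ≃ᵢ X) (x : X) : g • x = g x :=
  rfl

/-- The tautological action is isometric. [folklore] -/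
instance IsometryEquiv.isIsometricSMul : IsIsometricSMul (X ≃ᵢ X) X :=
  ⟨fun g ↦ g.isometry⟩

/-- Subgroups of `Isom(X)` act isometrically (through `Subgroup.instMulAction`). [folklore] -/
instance Subgroup.isIsometricSMul_isometryEquiv (S : Subgroup (X ≃ᵢ X)) : IsIsometricSMul S X :=
  ⟨fun g ↦ (g : X ≃ᵢ X).isometry⟩

/-- `g • x = g x` for `g` in a subgroup of `Isom(X)`. [folklore] -/
@[simp]
theorem Subgroup.smul_def_isometryEquiv {S : Subgroup (X ≃ᵢ X)} (g : S) (x : X) :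
    g • x = (g : X ≃ᵢ X) x :=
  rfl

end IsometryGroupAction

end Literature.Geometry.MetricGeometry

end
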